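import Literature.NumberTheory.LFunctions.UniformClassGroupPNTChebyshev
import Literature.NumberTheory.LFunctions.UniformClassGroupPNTTransferMain
import Literature.NumberTheory.LFunctions.UniformClassGroupPNTInputs
import HarnessLib

/-!
# Thorner–Zaman Theorem 1.4 for ideal classes of imaginary quadratic fields follows from its
# `θ`-form (Theorem 5.1 for `H_K/K`) and Stark's bound

Topic `Literature/NumberTheory/LFunctions` (namespace `Literature.NumberTheory.LFunctions.NumberField`).
Everything here is PROVED (theorems only; no definitions, no named facts).

The named fact `ThornerZaman2019_classPNT_imaginaryQuadratic` (`UniformClassGroupPNT.lean`) is the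
`π_C`-form of [ThornerZaman2019, Thm. 1.4] for `L/F = H_K/K`, `K` imaginary quadratic.  The
printed proof (§5.1, proof of Thm. 5.1) derives it from the corresponding statement for the
Chebyshev function of the class (there `ψ_C`, here `θ_C = chebyshevThetaIdealClass`) by partial
summation (Lemma 2.1 and (5.2)), absorbing the secondary errors `𝓔₀(x) ≪ x^{1/2}` by the lower
bound (4.8) for the main term, which rests on Stark's bound `λ₁ ≫ Q^{−2}` (Thm. 3.3).  This file
carries out exactly this reduction, with absolute constants:

* `exceptionalLiMain_ge` — the lower bound `Li(x) − θ₁ Li(x^β) ≥ x δ/(4 log x)` for `θ₁ = ±1`,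
  `δ ≤ 1 − β` (the `Li`-form of (4.8));
* `junk_le_errorTerm_mul` — absorption of `52 √x` into `errorTerm (c/2) Q x · x Q^{−s}/(4 h log x)`
  for `log x ≥ (48 + 8s) log Q`, `h ≤ Q²`;
* `ThornerZaman2019_classPNT_imaginaryQuadratic_of_thetaForm` — **the reduction**: the named fact
  follows from its `θ_C`-form (the dichotomy of Thm. 5.1 for `H_K/K` with the error
  `A · errorTerm c Q t` for `t ≥ Q^a`, absolute `a, c, A`) together with Stark's bound
  `1 − β₁ ≥ Q^{−s}` for the exceptional zero (absolute `s`), via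
  `primeIdealClassCount_eq_theta_div_log_add_integral` (Lemma 2.1, `θ`-form),
  `abs_sub_exceptionalLiMain_le` ((5.2)–(5.3)), `chebyshevThetaIdeal_le_mul` (Chebyshev),
  `classNumber_le_discr_sq` (`h_K ≤ d_K²`).

What is NOT here: the `θ_C`-form itself (zero-free region, log-free zero density with
Deuring–Heilbronn repulsion and the explicit formula for the class group `L`-functions, §§3–4 of the
paper) and Stark's bound — the analytic heart of [ThornerZaman2019].

## References

* J. Thorner, A. Zaman, *A unified and improved Chebotarev density theorem*, Algebra Number
  Theory 13 (2019) 1039–1068, Thm. 1.4, Thm. 3.3, (4.8), Thm. 5.1 and its proof. [ThornerZaman2019]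
-/

noncomputable section

open scoped NumberField
open Real MeasureTheory Set NumberField

namespace Literature.NumberTheory.LFunctions.NumberField

/-! ### The lower bound for the `Li`-main term with an exceptional zero -/

/-- **`Li(x) − θ₁ Li(x^β) ≥ x δ/(4 log x)`** for `x ≥ 256`, `θ₁ = ±1`, `1/2 < β < 1` and
`0 < δ ≤ min(1, 1 − β)`: for `θ₁ = −1` from `Li(x) ≥ x/(2 log x)`; for `θ₁ = 1` from
`Li(x) − Li(x^β) ≥ x(1 − x^{β−1})/log x` and `x^{β−1} ≤ e^{−δ} ≤ (1 + δ)⁻¹`.  The `Li`-form of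
[ThornerZaman2019, (4.8)]. [cite: ThornerZaman2019, (4.8)] -/
theorem exceptionalLiMain_ge {θ₁ β x δ : ℝ} (hθ : θ₁ = 1 ∨ θ₁ = -1) (hβ : 1 / 2 < β) (hβ1 : β < 1)
    (hδ0 : 0 < δ) (hδ1 : δ ≤ 1) (hδ : δ ≤ 1 - β) (hx : 256 ≤ x) :
    x * δ / (4 * Real.log x) ≤ offsetLogIntegral x - θ₁ * offsetLogIntegral (x ^ β) := by
  have hx1 : (1 : ℝ) < x := by linarith
  have hx0 : (0 : ℝ) < x := by linarith
  have hL1 : 1 ≤ Real.log x := by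
    rw [Real.le_log_iff_exp_le hx0]
    have he : Real.exp 1 < 2.7182818286 := Real.exp_one_lt_d9
    linarith
  have hL : 0 < Real.log x := by linarith
  have hLi : x / (2 * Real.log x) ≤ offsetLogIntegral x := div_two_mul_log_le_offsetLogIntegral hx
  rcases hθ with rfl | rfl
  · -- `θ₁ = 1`
    have hsub := sub_rpow_div_log_le_offsetLogIntegral_sub hx1 (by linarith : (0 : ℝ) < β) hβ1.le
    rw [one_mul]
    refine le_trans ?_ hsub
    have hxb : x ^ β = x * x ^ (β - 1) := by
      rw [Real.rpow_sub_one hx0.ne']; field_simp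
    have hexp : x ^ (β - 1) ≤ (1 + δ)⁻¹ := by
      rw [Real.rpow_def_of_pos hx0]
      calc Real.exp (Real.log x * (β - 1)) ≤ Real.exp (-δ) := by
            refine Real.exp_le_exp.mpr ?_
            nlinarith [mul_le_mul_of_nonneg_right hL1 (by linarith : (0 : ℝ) ≤ 1 - β)]
        _ = (Real.exp δ)⁻¹ := Real.exp_neg δ
        _ ≤ (1 + δ)⁻¹ := inv_anti₀ (by linarith) (by linarith [Real.add_one_le_exp δ])
    have hw : δ / 2 ≤ 1 - x ^ (β - 1) := by
      have h1 : 1 - (1 + δ)⁻¹ = δ / (1 + δ) := by field_simp; ring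
      have h2 : δ / 2 ≤ δ / (1 + δ) :=
        div_le_div_of_nonneg_left hδ0.le (by linarith) (by linarith)
      linarith
    rw [div_le_div_iff₀ (by positivity) hL, hxb]
    have hx4 : 0 ≤ x * Real.log x := by positivity
    nlinarith [mul_le_mul_of_nonneg_left hw hx4]
  · -- `θ₁ = −1`
    have hxβ2 : 2 ≤ x ^ β := by
      have h16 : (16 : ℝ) ≤ x ^ β := by
        calc (16 : ℝ) = 256 ^ (1 / 2 : ℝ) := by
              rw [show (256 : ℝ) = 16 ^ (2 : ℝ) by norm_num, ← Real.rpow_mul (by norm_num)]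
              norm_num
          _ ≤ x ^ (1 / 2 : ℝ) := Real.rpow_le_rpow (by norm_num) hx (by norm_num)
          _ ≤ x ^ β := Real.rpow_le_rpow_of_exponent_le hx1.le hβ.le
      linarith
    have hLiβ : 0 ≤ offsetLogIntegral (x ^ β) := by
      have := offsetLogIntegralPow_nonneg 1 hxβ2
      rwa [offsetLogIntegralPow_one] at this
    have h4 : x * δ / (4 * Real.log x) ≤ x / (2 * Real.log x) := by
      rw [div_le_div_iff₀ (by positivity) (by positivity)]
      have : x * δ ≤ x * 1 := mul_le_mul_of_nonneg_left hδ1 hx0.le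
      nlinarith
    rw [neg_one_mul, sub_neg_eq_add]
    linarith

/-! ### Absorption of the secondary errors -/

/-- `log 12 > 2`. [folklore] -/
theorem two_lt_log_twelve : 2 < Real.log 12 := by
  rw [Real.lt_log_iff_exp_lt (by norm_num)]
  have he : Real.exp 1 < 2.7182818286 := Real.exp_one_lt_d9
  have h2 : Real.exp 2 = Real.exp 1 * Real.exp 1 := by rw [← Real.exp_add]; norm_num
  nlinarith [Real.exp_pos 1]

/-- `1664 ≤ e⁸`. [folklore] -/
theorem exp_eight_ge : (1664 : ℝ) ≤ Real.exp 8 := by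
  have h1 : (2.7182818283 : ℝ) < Real.exp 1 := Real.exp_one_gt_d9
  have h8 : Real.exp 8 = Real.exp 1 ^ 8 := by
    rw [← Real.exp_nat_mul]; norm_num
  rw [h8]
  calc (1664 : ℝ) ≤ 2.7 ^ 8 := by norm_num
    _ ≤ Real.exp 1 ^ 8 := pow_le_pow_left₀ (by norm_num) (by linarith) 8

/-- **Absorption of the `O(√x)` terms** (the step "`𝓔₀(x) ≪ x^{1/2}` … can be absorbed" of the
proof of [ThornerZaman2019, Thm. 5.1]): for `Q ≥ 12`, `1 ≤ h ≤ Q²`, `s ≥ 0`, `0 < c ≤ 1` and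
`log x ≥ (48 + 8s) log Q`:
`52 √x ≤ errorTerm (c/2) Q x · (x Q^{−s}/(4 h log x))`. [cite: ThornerZaman2019, proof of Thm. 5.1] -/
theorem junk_le_errorTerm_mul {Q h s c x : ℝ} (hQ : 12 ≤ Q) (hh1 : 1 ≤ h) (hhQ : h ≤ Q ^ 2)
    (hs : 0 ≤ s) (hc1 : c ≤ 1) (hx0 : 0 < x)
    (hx : (48 + 8 * s) * Real.log Q ≤ Real.log x) :
    52 * Real.sqrt x ≤
      ThornerZaman.errorTerm (c / 2) Q x * (x * Q ^ (-s) / (4 * h * Real.log x)) := by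
  have hQ0 : 0 < Q := by linarith
  have hq2 : 2 < Real.log Q := two_lt_log_twelve.trans_le (Real.log_le_log (by norm_num) hQ)
  have hq0 : 0 < Real.log Q := by linarith
  have hsq : 0 ≤ s * Real.log Q := mul_nonneg hs hq0.le
  have hL48 : 48 * Real.log Q ≤ Real.log x := by nlinarith
  have hL0 : 0 < Real.log x := by linarith
  have hh0 : 0 < h := by linarith
  -- (1) the error term is at least `e^{-L/4}`
  have hE : Real.exp (-(Real.log x / 4)) ≤ ThornerZaman.errorTerm (c / 2) Q x := by
    refine le_trans (Real.exp_le_exp.mpr ?_) (ThornerZaman.exp_le_errorTerm _ _ _)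
    rw [neg_le_neg_iff, div_le_div_iff₀ hq0 (by norm_num)]
    nlinarith [mul_nonneg (by linarith : (0 : ℝ) ≤ Real.log Q - 2 * c) hL0.le]
  -- (2) exponential forms
  have hsqrt : Real.sqrt x = Real.exp (Real.log x / 2) := by
    rw [Real.sqrt_eq_rpow, Real.rpow_def_of_pos hx0, show Real.log x * (1 / 2) = Real.log x / 2 by ring]
  have hQs : Q ^ (-s) = Real.exp (-(s * Real.log Q)) := by
    rw [Real.rpow_def_of_pos hQ0, show Real.log Q * -s = -(s * Real.log Q) by ring]
  have hQ2 : Q ^ 2 = Real.exp (2 * Real.log Q) := by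
    rw [show (2 : ℝ) * Real.log Q = ((2 : ℕ) : ℝ) * Real.log Q by norm_num, Real.exp_nat_mul,
      Real.exp_log hQ0]
  have hhexp : h ≤ Real.exp (2 * Real.log Q) := hQ2 ▸ hhQ
  have hL8 : Real.log x ≤ 8 * Real.exp (Real.log x / 8) := by
    have := Real.add_one_le_exp (Real.log x / 8); linarith
  -- (3) the key exponent inequality
  have hkey : 1664 * Real.exp (2 * Real.log Q + 5 * Real.log x / 8) ≤
      Real.exp (3 * Real.log x / 4 - s * Real.log Q) := by
    have h8 : (8 : ℝ) ≤ Real.log x / 8 - (2 + s) * Real.log Q := by nlinarith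
    calc 1664 * Real.exp (2 * Real.log Q + 5 * Real.log x / 8)
        ≤ Real.exp 8 * Real.exp (2 * Real.log Q + 5 * Real.log x / 8) :=
          mul_le_mul_of_nonneg_right exp_eight_ge (Real.exp_nonneg _)
      _ ≤ Real.exp (Real.log x / 8 - (2 + s) * Real.log Q) *
            Real.exp (2 * Real.log Q + 5 * Real.log x / 8) :=
          mul_le_mul_of_nonneg_right (Real.exp_le_exp.mpr h8) (Real.exp_nonneg _)
      _ = Real.exp (3 * Real.log x / 4 - s * Real.log Q) := by
          rw [← Real.exp_add]; ring_nf
  -- (4) the claim in exponential form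
  have claim : 52 * Real.exp (Real.log x / 2) * (4 * h * Real.log x) ≤
      Real.exp (-(Real.log x / 4)) * (Real.exp (Real.log x) * Real.exp (-(s * Real.log Q))) := by
    calc 52 * Real.exp (Real.log x / 2) * (4 * h * Real.log x)
        = 208 * (h * Real.log x) * Real.exp (Real.log x / 2) := by ring
      _ ≤ 208 * (Real.exp (2 * Real.log Q) * (8 * Real.exp (Real.log x / 8))) *
            Real.exp (Real.log x / 2) := by
          refine mul_le_mul_of_nonneg_right (mul_le_mul_of_nonneg_left ?_ (by norm_num))
            (Real.exp_nonneg _)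
          exact mul_le_mul hhexp hL8 hL0.le (Real.exp_nonneg _)
      _ = 1664 * Real.exp (2 * Real.log Q + 5 * Real.log x / 8) := by
          rw [show 2 * Real.log Q + 5 * Real.log x / 8 =
            2 * Real.log Q + Real.log x / 8 + Real.log x / 2 by ring, Real.exp_add, Real.exp_add]
          ring
      _ ≤ Real.exp (3 * Real.log x / 4 - s * Real.log Q) := hkey
      _ = Real.exp (-(Real.log x / 4)) * (Real.exp (Real.log x) * Real.exp (-(s * Real.log Q))) := by
          rw [← Real.exp_add, ← Real.exp_add]; ring_nf
  rw [Real.exp_log hx0] at claim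
  -- (5) back to the goal
  have hpos : 0 < 4 * h * Real.log x := by positivity
  have hRHS : Real.exp (-(Real.log x / 4)) * (x * Q ^ (-s) / (4 * h * Real.log x)) ≤
      ThornerZaman.errorTerm (c / 2) Q x * (x * Q ^ (-s) / (4 * h * Real.log x)) :=
    mul_le_mul_of_nonneg_right hE (div_nonneg (mul_nonneg hx0.le (Real.rpow_nonneg hQ0.le _)) hpos.le)
  refine le_trans ?_ hRHS
  rw [hsqrt, hQs, ← mul_div_assoc, le_div_iff₀ hpos]
  exact claim

/-! ### The reduction -/

/-- **Thorner–Zaman's Theorem 1.4 for the ideal classes of imaginary quadratic fields, from its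
`θ`-form and Stark's bound.**  Suppose that with absolute constants `a, c, A, s > 0`, for every
imaginary quadratic field `K` (`Q = 4|d_K|`, `h = h_K`, `E(t) = errorTerm c Q t`) EITHER no real
class group character has a real zero of its `L`-function in `(1 − 1/(8 log Q), 1)` and
`|θ_C(t) − t/h| ≤ A E(t) t/h` for all classes `C` and `t ≥ Q^a`, OR there are a real `χ₁` and a real
zero `β₁ ∈ (1 − 1/(8 log Q), 1)` of `L(s, χ₁)` with Stark's bound `1 − β₁ ≥ Q^{−s}`
([ThornerZaman2019, Thm. 3.3]) and `|θ_C(t) − g_C(t)/h| ≤ A E(t) g_C(t)/h` for all `C`,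
`t ≥ Q^a`, where `g_C(t) = t − χ₁(C) t^{β₁}/β₁` (this is [ThornerZaman2019, Thm. 5.1] for
`L/K = H_K/K`, in `θ`-form).  THEN the named fact `ThornerZaman2019_classPNT_imaginaryQuadratic`
holds (with `c₁ = max(2a, 48 + 8s)`, `c₂ = min(c,1)/2`, `c₃ = 30A + 1`).  This is the last
paragraph of the proof of [ThornerZaman2019, Thm. 5.1] (partial summation, Lemma 2.1, (5.2),
absorption of `𝓔₀(x) ≪ x^{1/2}` by (4.8)). [cite: ThornerZaman2019, Thm. 1.4 (proof of Thm. 5.1)] -/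
theorem ThornerZaman2019_classPNT_imaginaryQuadratic_of_thetaForm
    (H : ∃ a c A s : ℝ, 0 < a ∧ 0 < c ∧ 0 < A ∧ 0 < s ∧
      ∀ (K : Type) [Field K] [NumberField K], Module.finrank ℚ K = 2 → IsTotallyComplex K →
        ((∀ χ : ClassGroup (𝓞 K) →* ℂˣ, χ * χ = 1 →
            ∀ β : ℝ, 1 - 1 / (8 * Real.log (ThornerZaman.condQ K)) < β → β < 1 →
              classGroupLFunction K χ β ≠ 0) ∧
          ∀ (C : ClassGroup (𝓞 K)) (t : ℝ), ThornerZaman.condQ K ^ a ≤ t →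
            |chebyshevThetaIdealClass K C t - t / classNumber K| ≤
              A * ThornerZaman.errorTerm c (ThornerZaman.condQ K) t * (t / classNumber K)) ∨
        ∃ (χ₁ : ClassGroup (𝓞 K) →* ℂˣ) (β₁ : ℝ), χ₁ * χ₁ = 1 ∧
          1 - 1 / (8 * Real.log (ThornerZaman.condQ K)) < β₁ ∧ β₁ < 1 ∧
          classGroupLFunction K χ₁ β₁ = 0 ∧
          ThornerZaman.condQ K ^ (-s) ≤ 1 - β₁ ∧
          ∀ (C : ClassGroup (𝓞 K)) (t : ℝ), ThornerZaman.condQ K ^ a ≤ t →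
            |chebyshevThetaIdealClass K C t -
                (t - ((χ₁ C : ℂ)).re * t ^ β₁ / β₁) / classNumber K| ≤
              A * ThornerZaman.errorTerm c (ThornerZaman.condQ K) t *
                ((t - ((χ₁ C : ℂ)).re * t ^ β₁ / β₁) / classNumber K)) :
    ThornerZaman2019_classPNT_imaginaryQuadratic := by
  obtain ⟨a, c, A, s, ha, hc, hA, hs, hH⟩ := H
  have hc'0 : 0 < min c 1 := lt_min hc one_pos
  have hc'1 : min c 1 ≤ 1 := min_le_right _ _
  have hc'c : min c 1 ≤ c := min_le_left _ _
  refine ⟨max (2 * a) (48 + 8 * s), min c 1 / 2, 30 * A + 1, by positivity, by positivity,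
    by positivity, ?_⟩
  intro K _ _ h2 htc
  -- constants of the field
  have hQ12 : 12 ≤ ThornerZaman.condQ K := ThornerZaman.twelve_le_condQ (by omega)
  have hQ1 : 1 < ThornerZaman.condQ K := by linarith
  have hQ0 : 0 < ThornerZaman.condQ K := by linarith
  have hq2 : 2 < Real.log (ThornerZaman.condQ K) :=
    two_lt_log_twelve.trans_le (Real.log_le_log (by norm_num) hQ12)
  have hh1 : (1 : ℝ) ≤ classNumber K := by exact_mod_cast one_le_classNumber
  have hh0 : (0 : ℝ) < classNumber K := by linarith
  have hhQ : (classNumber K : ℝ) ≤ ThornerZaman.condQ K ^ 2 := by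
    refine (classNumber_le_discr_sq h2 htc).trans ?_
    rw [ThornerZaman.condQ]
    nlinarith [sq_nonneg (NumberField.discr K : ℝ), sq_abs (NumberField.discr K : ℝ),
      abs_nonneg (NumberField.discr K : ℝ)]
  -- Chebyshev, uniformly: `θ_C(t) ≤ 2 (log 4 + 4) t`
  have hlog4 : Real.log 4 ≤ 1.5 := by
    have : Real.log 4 = 2 * Real.log 2 := by
      rw [show (4 : ℝ) = 2 ^ 2 by norm_num, Real.log_pow]; norm_num
    rw [this]
    linarith [Real.log_two_lt_d9]
  have hB0 : (0 : ℝ) ≤ 2 * (Real.log 4 + 4) := by positivity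
  have hTB : ∀ (C : ClassGroup (𝓞 K)) (t : ℝ), 2 ≤ t →
      chebyshevThetaIdealClass K C t ≤ 2 * (Real.log 4 + 4) * t := by
    intro C t ht
    refine (chebyshevThetaIdealClass_le_chebyshevThetaIdeal C t).trans ?_
    have := chebyshevThetaIdeal_le_mul K (x := t) (by linarith)
    rw [h2] at this
    exact_mod_cast this
  -- the error term with `c' = min c 1`, non-increasing, and dominating the one with `c`
  have hEanti : AntitoneOn (ThornerZaman.errorTerm (min c 1) (ThornerZaman.condQ K)) (Ici 2) :=
    (ThornerZaman.errorTerm_antitoneOn hc'0.le hQ1).mono (Ici_subset_Ici.mpr one_le_two)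
  have hE0 : ∀ t : ℝ, 2 ≤ t → 0 ≤ ThornerZaman.errorTerm (min c 1) (ThornerZaman.condQ K) t :=
    fun t _ ↦ (ThornerZaman.errorTerm_pos _ _ _).le
  have hEc : ∀ t : ℝ, 1 ≤ t → ThornerZaman.errorTerm c (ThornerZaman.condQ K) t ≤
      ThornerZaman.errorTerm (min c 1) (ThornerZaman.condQ K) t := by
    intro t ht
    have hlt : 0 ≤ Real.log t := Real.log_nonneg ht
    have hlQ : 0 < Real.log (ThornerZaman.condQ K) := by linarith
    unfold ThornerZaman.errorTerm
    refine add_le_add (Real.exp_le_exp.mpr ?_) (Real.exp_le_exp.mpr ?_)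
    · have : min c 1 * Real.log t / Real.log (ThornerZaman.condQ K) ≤
          c * Real.log t / Real.log (ThornerZaman.condQ K) :=
        div_le_div_of_nonneg_right (mul_le_mul_of_nonneg_right hc'c hlt) hlQ.le
      linarith
    · have : Real.sqrt (min c 1 * Real.log t / 2) ≤ Real.sqrt (c * Real.log t / 2) :=
        Real.sqrt_le_sqrt (by nlinarith)
      linarith
  -- the range `x ≥ Q^{c₁}`
  have hrange : ∀ x : ℝ, ThornerZaman.condQ K ^ max (2 * a) (48 + 8 * s) ≤ x →
      0 < x ∧ 256 ≤ x ∧ (max 2 (ThornerZaman.condQ K ^ a)) ^ 2 ≤ x ∧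
        (48 + 8 * s) * Real.log (ThornerZaman.condQ K) ≤ Real.log x := by
    intro x hx
    have hxpos : 0 < x := lt_of_lt_of_le (Real.rpow_pos_of_pos hQ0 _) hx
    have h2a : ThornerZaman.condQ K ^ (2 * a) ≤ x :=
      (Real.rpow_le_rpow_of_exponent_le hQ1.le (le_max_left _ _)).trans hx
    have h48 : ThornerZaman.condQ K ^ (48 + 8 * s) ≤ x :=
      (Real.rpow_le_rpow_of_exponent_le hQ1.le (le_max_right _ _)).trans hx
    have hlog : (48 + 8 * s) * Real.log (ThornerZaman.condQ K) ≤ Real.log x := by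
      rw [← Real.log_rpow hQ0]
      exact Real.log_le_log (Real.rpow_pos_of_pos hQ0 _) h48
    have h256 : 256 ≤ x := by
      have hl256 : Real.log 256 ≤ Real.log x := by
        have : Real.log 256 = 8 * Real.log 2 := by
          rw [show (256 : ℝ) = 2 ^ 8 by norm_num, Real.log_pow]; norm_num
        have h96 : (96 : ℝ) ≤ Real.log x := by nlinarith
        linarith [Real.log_two_lt_d9]
      exact (Real.log_le_log_iff (by norm_num) hxpos).mp hl256
    refine ⟨hxpos, h256, ?_, hlog⟩
    rcases le_total 2 (ThornerZaman.condQ K ^ a) with hm | hm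
    · rw [max_eq_right hm, ← Real.rpow_natCast, ← Real.rpow_mul hQ0.le]
      rw [show a * ((2 : ℕ) : ℝ) = 2 * a by push_cast; ring]
      exact h2a
    · rw [max_eq_left hm]
      linarith
  have hy2 : (2 : ℝ) ≤ max 2 (ThornerZaman.condQ K ^ a) := le_max_left _ _
  -- the dichotomy
  rcases hH K h2 htc with ⟨hzf, hθ⟩ | ⟨χ₁, β₁, hχ₁, hβl, hβu, hL0, hstark, hθ⟩
  · -- no exceptional zero
    refine Or.inl ⟨hzf, fun C x hx ↦ ?_⟩
    obtain ⟨hx0, hx256, hyx, hlogx⟩ := hrange x hx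
    have hx2 : (2 : ℝ) ≤ x := by linarith
    have hTE : ∀ t : ℝ, max 2 (ThornerZaman.condQ K ^ a) ≤ t →
        |chebyshevThetaIdealClass K C t - (t - 0 * t ^ (1 : ℝ) / 1) / classNumber K| ≤
          A * ThornerZaman.errorTerm (min c 1) (ThornerZaman.condQ K) t *
            ((t - 0 * t ^ (1 : ℝ) / 1) / classNumber K) := by
      intro t ht
      have ht2 : 2 ≤ t := hy2.trans ht
      have hta : ThornerZaman.condQ K ^ a ≤ t := (le_max_right _ _).trans ht
      have h1 := hθ C t hta
      simp only [zero_mul, zero_div, sub_zero]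
      refine h1.trans (mul_le_mul_of_nonneg_right (mul_le_mul_of_nonneg_left
        (hEc t (by linarith)) hA.le) (by positivity))
    have hT := abs_sub_exceptionalLiMain_le (T := chebyshevThetaIdealClass K C)
      (E := ThornerZaman.errorTerm (min c 1) (ThornerZaman.condQ K))
      (P := (primeIdealClassCount K C x : ℝ)) (h := classNumber K) (θ₁ := 0) (β := 1) (A := A)
      (B := 2 * (Real.log 4 + 4)) (y := max 2 (ThornerZaman.condQ K ^ a)) (x := x) hh0
      (by norm_num) (by norm_num) le_rfl hA.le hB0 hy2
      (fun t _ ↦ chebyshevThetaIdealClass_nonneg C t) (hTB C) hEanti hE0 hTE hx256 hyx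
      ((intervalIntegrable_iff_integrableOn_Icc_of_le hx2).mpr
        (integrableOn_chebyshevThetaIdealClass_div K C x))
      (primeIdealClassCount_eq_theta_div_log_add_integral K C hx2)
    simp only [zero_mul, sub_zero] at hT
    rw [ThornerZaman.errorTerm_sqrt _ _ hx0.le] at hT
    -- absorption
    have hjunk := junk_le_errorTerm_mul hQ12 hh1 hhQ hs.le hc'1 hx0 hlogx
    have hLi : x * ThornerZaman.condQ K ^ (-s) / (4 * classNumber K * Real.log x) ≤
        offsetLogIntegral x / classNumber K := by
      have hL : 0 < Real.log x := Real.log_pos (by linarith)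
      have h1 : ThornerZaman.condQ K ^ (-s) ≤ 1 :=
        Real.rpow_le_one_of_one_le_of_nonpos hQ1.le (by linarith)
      have h2' := div_two_mul_log_le_offsetLogIntegral hx256
      rw [div_le_div_iff₀ (by positivity) hh0]
      rw [div_le_iff₀ (by positivity)] at h2'
      have h3 : x * ThornerZaman.condQ K ^ (-s) ≤ x * 1 :=
        mul_le_mul_of_nonneg_left h1 hx0.le
      nlinarith [mul_nonneg hh0.le hL.le]
    have hE'0 : 0 ≤ ThornerZaman.errorTerm (min c 1 / 2) (ThornerZaman.condQ K) x :=
      (ThornerZaman.errorTerm_pos _ _ _).le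
    have hB52 : (3 * (2 * (Real.log 4 + 4)) + 19 / classNumber K) * Real.sqrt x ≤
        52 * Real.sqrt x := by
      refine mul_le_mul_of_nonneg_right ?_ (Real.sqrt_nonneg _)
      have : 19 / (classNumber K : ℝ) ≤ 19 := div_le_self (by norm_num) hh1
      linarith
    have hfin : (3 * (2 * (Real.log 4 + 4)) + 19 / classNumber K) * Real.sqrt x ≤
        ThornerZaman.errorTerm (min c 1 / 2) (ThornerZaman.condQ K) x *
          (offsetLogIntegral x / classNumber K) :=
      hB52.trans (hjunk.trans (mul_le_mul_of_nonneg_left hLi hE'0))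
    have hmain0 : 0 ≤ A * ThornerZaman.errorTerm (min c 1 / 2) (ThornerZaman.condQ K) x *
        (offsetLogIntegral x / classNumber K) := by
      have hL : 0 < Real.log x := Real.log_pos (by linarith)
      have : 0 ≤ offsetLogIntegral x / classNumber K :=
        div_nonneg ((div_nonneg hx0.le (by positivity)).trans
          (div_two_mul_log_le_offsetLogIntegral hx256)) hh0.le
      positivity
    nlinarith
  · -- an exceptional zero `β₁` of the real character `χ₁`
    refine Or.inr ⟨χ₁, β₁, hχ₁, hβl, hβu, hL0, fun C x hx ↦ ?_⟩
    obtain ⟨hx0, hx256, hyx, hlogx⟩ := hrange x hx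
    have hx2 : (2 : ℝ) ≤ x := by linarith
    have hθ1 : ((χ₁ C : ℂ)).re = 1 ∨ ((χ₁ C : ℂ)).re = -1 := re_classGroupChar_apply hχ₁ C
    have hθabs : |((χ₁ C : ℂ)).re| ≤ 1 := abs_re_classGroupChar_apply_le hχ₁ C
    have hβhalf : 1 / 2 < β₁ := by
      have h16 : 1 / (8 * Real.log (ThornerZaman.condQ K)) ≤ 1 / 16 :=
        one_div_le_one_div_of_le (by norm_num) (by linarith)
      linarith
    have hTE : ∀ t : ℝ, max 2 (ThornerZaman.condQ K ^ a) ≤ t →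
        |chebyshevThetaIdealClass K C t -
            (t - ((χ₁ C : ℂ)).re * t ^ β₁ / β₁) / classNumber K| ≤
          A * ThornerZaman.errorTerm (min c 1) (ThornerZaman.condQ K) t *
            ((t - ((χ₁ C : ℂ)).re * t ^ β₁ / β₁) / classNumber K) := by
      intro t ht
      have ht2 : 2 ≤ t := hy2.trans ht
      have hta : ThornerZaman.condQ K ^ a ≤ t := (le_max_right _ _).trans ht
      have h1 := hθ C t hta
      have hg0 : 0 ≤ (t - ((χ₁ C : ℂ)).re * t ^ β₁ / β₁) / classNumber K := by
        -- from `h1`: `0 ≤ |…| ≤ A E g/h` with `A E > 0`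
        have hAE : 0 < A * ThornerZaman.errorTerm c (ThornerZaman.condQ K) t :=
          mul_pos hA (ThornerZaman.errorTerm_pos _ _ _)
        refine le_of_mul_le_mul_left ?_ hAE
        rw [mul_zero]
        exact (abs_nonneg _).trans h1
      exact h1.trans (mul_le_mul_of_nonneg_right (mul_le_mul_of_nonneg_left
        (hEc t (by linarith)) hA.le) hg0)
    have hT := abs_sub_exceptionalLiMain_le (T := chebyshevThetaIdealClass K C)
      (E := ThornerZaman.errorTerm (min c 1) (ThornerZaman.condQ K))
      (P := (primeIdealClassCount K C x : ℝ)) (h := classNumber K) (θ₁ := ((χ₁ C : ℂ)).re)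
      (β := β₁) (A := A) (B := 2 * (Real.log 4 + 4)) (y := max 2 (ThornerZaman.condQ K ^ a))
      (x := x) hh0 hθabs hβhalf hβu.le hA.le hB0 hy2
      (fun t _ ↦ chebyshevThetaIdealClass_nonneg C t) (hTB C) hEanti hE0 hTE hx256 hyx
      ((intervalIntegrable_iff_integrableOn_Icc_of_le hx2).mpr
        (integrableOn_chebyshevThetaIdealClass_div K C x))
      (primeIdealClassCount_eq_theta_div_log_add_integral K C hx2)
    rw [ThornerZaman.errorTerm_sqrt _ _ hx0.le] at hT
    -- absorption, using Stark's bound through `exceptionalLiMain_ge`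
    have hjunk := junk_le_errorTerm_mul hQ12 hh1 hhQ hs.le hc'1 hx0 hlogx
    have hδ1 : ThornerZaman.condQ K ^ (-s) ≤ 1 :=
      Real.rpow_le_one_of_one_le_of_nonpos hQ1.le (by linarith)
    have hG := exceptionalLiMain_ge hθ1 hβhalf hβu (Real.rpow_pos_of_pos hQ0 _) hδ1 hstark hx256
    have hLi : x * ThornerZaman.condQ K ^ (-s) / (4 * classNumber K * Real.log x) ≤
        (offsetLogIntegral x - ((χ₁ C : ℂ)).re * offsetLogIntegral (x ^ β₁)) / classNumber K := by
      have hL : 0 < Real.log x := Real.log_pos (by linarith)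
      rw [show x * ThornerZaman.condQ K ^ (-s) / (4 * classNumber K * Real.log x) =
        x * ThornerZaman.condQ K ^ (-s) / (4 * Real.log x) / classNumber K by
          field_simp]
      exact div_le_div_of_nonneg_right hG hh0.le
    have hE'0 : 0 ≤ ThornerZaman.errorTerm (min c 1 / 2) (ThornerZaman.condQ K) x :=
      (ThornerZaman.errorTerm_pos _ _ _).le
    have hB52 : (3 * (2 * (Real.log 4 + 4)) + 19 / classNumber K) * Real.sqrt x ≤
        52 * Real.sqrt x := by
      refine mul_le_mul_of_nonneg_right ?_ (Real.sqrt_nonneg _)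
      have : 19 / (classNumber K : ℝ) ≤ 19 := div_le_self (by norm_num) hh1
      linarith
    have hfin : (3 * (2 * (Real.log 4 + 4)) + 19 / classNumber K) * Real.sqrt x ≤
        ThornerZaman.errorTerm (min c 1 / 2) (ThornerZaman.condQ K) x *
          ((offsetLogIntegral x - ((χ₁ C : ℂ)).re * offsetLogIntegral (x ^ β₁)) /
            classNumber K) :=
      hB52.trans (hjunk.trans (mul_le_mul_of_nonneg_left hLi hE'0))
    have hG0 : 0 ≤ (offsetLogIntegral x - ((χ₁ C : ℂ)).re * offsetLogIntegral (x ^ β₁)) /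
        classNumber K := by
      refine div_nonneg (le_trans ?_ hG) hh0.le
      have : 0 < Real.log x := Real.log_pos (by linarith)
      positivity
    have hmain0 : 0 ≤ A * ThornerZaman.errorTerm (min c 1 / 2) (ThornerZaman.condQ K) x *
        ((offsetLogIntegral x - ((χ₁ C : ℂ)).re * offsetLogIntegral (x ^ β₁)) /
          classNumber K) := by positivity
    nlinarith

end Literature.NumberTheory.LFunctions.NumberField

end
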